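import Literature.MathematicalPhysics.QuantumManyBody.PeriodicBoseGasFourier
import HarnessLib

/-!
# Route `BECConjugateDomination`, glue `IMUChainGlue` (stmt-AtomisticToContinuum-11790) —
# helper: lattice-point counting in `ℤ³`

The `d = 3` lattice sum behind step (v) of the glue: with `‖n‖∞ = maxⱼ |nⱼ|` and the cubes
`{-M,…,M}³ = Finset.Icc (-M) M`, one has `#{‖n‖∞ = j} = (2j+1)³ − (2j−1)³ ≤ 26 j²`, whence
`∑_{0 < ‖n‖∞ ≤ M} 1/‖n‖∞ ≤ 26 M²`; and for a weight `0 ≤ c ≤ 1` on `ℤ³` with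
`∑ₙ ‖n‖² cₙ = A'` (Euclidean norm), splitting at `‖n‖∞ = M` gives
`∑_{n ≠ 0} cₙ/‖n‖ ≤ 26 M² + A'/M³`.  This is the place where the dimension enters the proof of
`IMUChainGlue` (the sum `∑ 1/|k|` over `|k| ≲ κ` is finite per unit volume iff `d ≥ 2`).
-/

noncomputable section

open Finset

namespace Summit.AtomisticToContinuum.BoseEinsteinCondensation.Theorems.IMUChainGlue

open Literature.MathematicalPhysics.QuantumManyBody.BoseGas

/-- The sup norm `‖n‖∞ = maxⱼ |nⱼ| ∈ ℕ` of `n ∈ ℤ³` (local notation). -/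
local notation "supNorm⟦" n "⟧" => Finset.sup Finset.univ (fun i : Fin 3 => Int.natAbs (n i))

/-- The cube `{-M,…,M}³ ⊂ ℤ³` (local notation). -/
local notation "cube⟦" M "⟧" => Finset.Icc (-((M : ℕ) : Fin 3 → ℤ)) ((M : ℕ) : Fin 3 → ℤ)

/-- `|nᵢ| ≤ ‖n‖∞`. -/
theorem natAbs_le_supNorm (n : Fin 3 → ℤ) (i : Fin 3) : Int.natAbs (n i) ≤ supNorm⟦n⟧ :=
  Finset.le_sup (f := fun i => Int.natAbs (n i)) (Finset.mem_univ i)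

/-- Membership in the cube `{-M,…,M}³`: `‖n‖∞ ≤ M`. -/
theorem mem_cube_iff (M : ℕ) (n : Fin 3 → ℤ) : n ∈ cube⟦M⟧ ↔ supNorm⟦n⟧ ≤ M := by
  simp only [Finset.mem_Icc, Pi.le_def, Pi.neg_apply, Pi.natCast_apply, Finset.sup_le_iff,
    Finset.mem_univ, forall_true_left]
  constructor
  · rintro ⟨h1, h2⟩ i
    have := h1 i; have := h2 i
    omega
  · intro h
    exact ⟨fun i => by have := h i; omega, fun i => by have := h i; omega⟩

/-- `‖n‖∞ = 0 ↔ n = 0`. -/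
theorem supNorm_eq_zero_iff (n : Fin 3 → ℤ) : supNorm⟦n⟧ = 0 ↔ n = 0 := by
  constructor
  · intro h
    funext i
    have := natAbs_le_supNorm n i
    rw [h] at this
    simpa using this
  · rintro rfl
    simp

/-- The cardinality of the cube `{-M,…,M}³` is `(2M+1)³`. -/
theorem card_cube (M : ℕ) : Finset.card cube⟦M⟧ = (2 * M + 1) ^ 3 := by
  rw [Pi.card_Icc]
  simp only [Pi.neg_apply, Pi.natCast_apply, Int.card_Icc, Finset.prod_const, Finset.card_univ,
    Fintype.card_fin]
  congr 1
  omega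

/-- The cubes are nested. -/
theorem cube_subset_cube_succ (M : ℕ) : cube⟦M⟧ ⊆ cube⟦M + 1⟧ := by
  intro n hn
  rw [mem_cube_iff] at hn ⊢
  omega

/-- `‖n‖∞ ≤ ‖n‖₂`: the sup norm is dominated by the Euclidean norm. -/
theorem supNorm_le_norm (n : Fin 3 → ℤ) : ((supNorm⟦n⟧ : ℕ) : ℝ) ≤ ‖latticeVec 1 n‖ := by
  obtain ⟨i, -, hi⟩ := Finset.exists_mem_eq_sup (Finset.univ : Finset (Fin 3)) Finset.univ_nonempty
    (fun i => Int.natAbs (n i))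
  rw [hi]
  have h := PiLp.norm_apply_le (latticeVec 1 n) i
  have h2 : ‖latticeVec 1 n i‖ = ((Int.natAbs (n i) : ℕ) : ℝ) := by
    simp only [latticeVec, PiLp.toLp_apply, one_mul, Real.norm_eq_abs]
    rw [Nat.cast_natAbs, Int.cast_abs]
  linarith [h2.symm.le]

/-- **The infrared shell count**: `∑_{0 < ‖n‖∞ ≤ M} 1/‖n‖∞ ≤ 26 M²`
(shell by shell: `#{‖n‖∞ = j} = (2j+1)³ − (2j−1)³ = 24j² + 2 ≤ 26 j²`). -/
theorem sum_cube_inv_supNorm_le (M : ℕ) :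
    ∑ n ∈ cube⟦M⟧, (if n = 0 then (0 : ℝ) else (((supNorm⟦n⟧ : ℕ) : ℝ))⁻¹) ≤ 26 * (M : ℝ) ^ 2 := by
  induction M with
  | zero =>
      have h0 : cube⟦0⟧ = {0} := by
        ext n
        rw [mem_cube_iff, Finset.mem_singleton, Nat.le_zero, supNorm_eq_zero_iff]
      rw [h0, Finset.sum_singleton, if_pos rfl]
      positivity
  | succ M ih =>
      rw [← Finset.sum_sdiff (cube_subset_cube_succ M)]
      -- on the shell `‖n‖∞ = M+1` every term is `1/(M+1)`
      have hshell : ∀ n ∈ cube⟦M + 1⟧ \ cube⟦M⟧,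
          (if n = 0 then (0 : ℝ) else (((supNorm⟦n⟧ : ℕ) : ℝ))⁻¹) = ((M : ℝ) + 1)⁻¹ := by
        intro n hn
        rw [Finset.mem_sdiff, mem_cube_iff, mem_cube_iff] at hn
        have hs : supNorm⟦n⟧ = M + 1 := by omega
        have hne : n ≠ 0 := by
          intro h
          rw [(supNorm_eq_zero_iff n).2 h] at hs
          omega
        rw [if_neg hne, hs]
        push_cast
        rfl
      rw [Finset.sum_congr rfl hshell, Finset.sum_const, Finset.card_sdiff_of_subset
        (cube_subset_cube_succ M), card_cube, card_cube, nsmul_eq_mul]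
      have hcard : (((2 * (M + 1) + 1) ^ 3 - (2 * M + 1) ^ 3 : ℕ) : ℝ) ≤ 26 * ((M : ℝ) + 1) ^ 2 := by
        have h1 : (2 * M + 1) ^ 3 ≤ (2 * (M + 1) + 1) ^ 3 := Nat.pow_le_pow_left (by omega) 3
        rw [Nat.cast_sub h1]
        push_cast
        have hM0 : (0 : ℝ) ≤ M := Nat.cast_nonneg M
        nlinarith [hM0, sq_nonneg (M : ℝ)]
      have hM1 : (0 : ℝ) < (M : ℝ) + 1 := by positivity
      calc (((2 * (M + 1) + 1) ^ 3 - (2 * M + 1) ^ 3 : ℕ) : ℝ) * ((M : ℝ) + 1)⁻¹ +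
            ∑ n ∈ cube⟦M⟧, (if n = 0 then (0 : ℝ) else (((supNorm⟦n⟧ : ℕ) : ℝ))⁻¹)
          ≤ 26 * ((M : ℝ) + 1) ^ 2 * ((M : ℝ) + 1)⁻¹ + 26 * (M : ℝ) ^ 2 := by
            gcongr
        _ = 26 * ((M : ℝ) + 1) + 26 * (M : ℝ) ^ 2 := by field_simp
        _ ≤ 26 * ((M + 1 : ℕ) : ℝ) ^ 2 := by push_cast; nlinarith

/-- **The lattice sum of step (v).** For a weight `0 ≤ cₙ ≤ 1` on `ℤ³` with `∑ₙ ‖n‖² cₙ = A'`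
(Euclidean norm `‖n‖ = ‖latticeVec 1 n‖`) and a cut-off `M ≥ 1`: every finite partial sum of
`∑_{n ≠ 0} cₙ/‖n‖` is at most `26 M² + A'/M³`. -/
theorem sum_weight_div_norm_le {c : (Fin 3 → ℤ) → ℝ} (hc0 : ∀ n, 0 ≤ c n) (hc1 : ∀ n, c n ≤ 1)
    {A' : ℝ} (hA : HasSum (fun n => ‖latticeVec 1 n‖ ^ 2 * c n) A') {M : ℕ} (hM : 1 ≤ M)
    (s : Finset (Fin 3 → ℤ)) :
    ∑ n ∈ s, (if n = 0 then 0 else c n / ‖latticeVec 1 n‖) ≤ 26 * (M : ℝ) ^ 2 + A' / (M : ℝ) ^ 3 := by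
  classical
  have hMpos : (0 : ℝ) < M := by exact_mod_cast hM
  have hnn : ∀ n, 0 ≤ (if n = 0 then 0 else c n / ‖latticeVec 1 n‖) := fun n => by
    split_ifs
    · exact le_rfl
    · exact div_nonneg (hc0 n) (norm_nonneg _)
  rw [← Finset.sum_filter_add_sum_filter_not s (fun n => supNorm⟦n⟧ ≤ M)]
  refine add_le_add ?_ ?_
  · -- infrared part: `cₙ ≤ 1`, `‖n‖ ≥ ‖n‖∞`, then the shell count
    calc ∑ n ∈ s.filter (fun n => supNorm⟦n⟧ ≤ M), (if n = 0 then 0 else c n / ‖latticeVec 1 n‖)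
        ≤ ∑ n ∈ cube⟦M⟧, (if n = 0 then 0 else c n / ‖latticeVec 1 n‖) := by
          refine Finset.sum_le_sum_of_subset_of_nonneg (fun n hn => ?_) (fun n _ _ => hnn n)
          rw [Finset.mem_filter] at hn
          exact (mem_cube_iff M n).2 hn.2
      _ ≤ ∑ n ∈ cube⟦M⟧, (if n = 0 then (0 : ℝ) else (((supNorm⟦n⟧ : ℕ) : ℝ))⁻¹) := by
          refine Finset.sum_le_sum fun n _ => ?_
          split_ifs with hn
          · exact le_rfl
          · have hs : 0 < ((supNorm⟦n⟧ : ℕ) : ℝ) := by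
              have : supNorm⟦n⟧ ≠ 0 := fun h => hn ((supNorm_eq_zero_iff n).1 h)
              positivity
            rw [div_le_iff₀ (lt_of_lt_of_le hs (supNorm_le_norm n))]
            calc c n ≤ 1 := hc1 n
              _ = ((supNorm⟦n⟧ : ℕ) : ℝ)⁻¹ * ((supNorm⟦n⟧ : ℕ) : ℝ) := by field_simp
              _ ≤ ((supNorm⟦n⟧ : ℕ) : ℝ)⁻¹ * ‖latticeVec 1 n‖ := by gcongr; exact supNorm_le_norm n
      _ ≤ 26 * (M : ℝ) ^ 2 := sum_cube_inv_supNorm_le M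
  · -- ultraviolet part: `1/‖n‖ ≤ ‖n‖²/M³` for `‖n‖∞ > M`
    calc ∑ n ∈ s.filter (fun n => ¬ supNorm⟦n⟧ ≤ M), (if n = 0 then 0 else c n / ‖latticeVec 1 n‖)
        ≤ ∑ n ∈ s.filter (fun n => ¬ supNorm⟦n⟧ ≤ M), ‖latticeVec 1 n‖ ^ 2 * c n / (M : ℝ) ^ 3 := by
          refine Finset.sum_le_sum fun n hn => ?_
          rw [Finset.mem_filter, not_le] at hn
          have hne : n ≠ 0 := by
            intro h
            have := hn.2
            rw [(supNorm_eq_zero_iff n).2 h] at this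
            omega
          rw [if_neg hne]
          have hMn : (M : ℝ) < ‖latticeVec 1 n‖ := by
            have h1 : ((M : ℕ) : ℝ) + 1 ≤ ((supNorm⟦n⟧ : ℕ) : ℝ) := by exact_mod_cast hn.2
            linarith [supNorm_le_norm n]
          have hnpos : 0 < ‖latticeVec 1 n‖ := hMpos.trans hMn
          rw [div_le_div_iff₀ hnpos (by positivity)]
          have h3 : (M : ℝ) ^ 3 ≤ ‖latticeVec 1 n‖ ^ 3 := by gcongr
          calc c n * (M : ℝ) ^ 3 ≤ c n * ‖latticeVec 1 n‖ ^ 3 := by gcongr; exact hc0 n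
            _ = ‖latticeVec 1 n‖ ^ 2 * c n * ‖latticeVec 1 n‖ := by ring
      _ = (∑ n ∈ s.filter (fun n => ¬ supNorm⟦n⟧ ≤ M), ‖latticeVec 1 n‖ ^ 2 * c n) / (M : ℝ) ^ 3 := by
          rw [Finset.sum_div]
      _ ≤ A' / (M : ℝ) ^ 3 := by
          gcongr
          exact sum_le_hasSum _ (fun n _ => mul_nonneg (sq_nonneg _) (hc0 n)) hA

/-- **The lattice sum of step (v), `tsum` form**: under the same hypotheses the series
`∑_{n ≠ 0} cₙ/‖n‖` is summable with sum at most `26 M² + A'/M³`. -/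
theorem tsum_weight_div_norm_le {c : (Fin 3 → ℤ) → ℝ} (hc0 : ∀ n, 0 ≤ c n) (hc1 : ∀ n, c n ≤ 1)
    {A' : ℝ} (hA : HasSum (fun n => ‖latticeVec 1 n‖ ^ 2 * c n) A') {M : ℕ} (hM : 1 ≤ M) :
    Summable (fun n : Fin 3 → ℤ => if n = 0 then 0 else c n / ‖latticeVec 1 n‖) ∧
      ∑' n : Fin 3 → ℤ, (if n = 0 then 0 else c n / ‖latticeVec 1 n‖) ≤
        26 * (M : ℝ) ^ 2 + A' / (M : ℝ) ^ 3 := by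
  have hnn : ∀ n, 0 ≤ (if n = 0 then 0 else c n / ‖latticeVec 1 n‖) := fun n => by
    split_ifs
    · exact le_rfl
    · exact div_nonneg (hc0 n) (norm_nonneg _)
  exact ⟨summable_of_sum_le hnn (sum_weight_div_norm_le hc0 hc1 hA hM),
    Real.tsum_le_of_sum_le hnn (sum_weight_div_norm_le hc0 hc1 hA hM)⟩

end Summit.AtomisticToContinuum.BoseEinsteinCondensation.Theorems.IMUChainGlue

end
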